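/-
Copyright (c) 2026 the pub-hodgecm-mathlib formalisation cell (harness21).  Prover seat hodgecm-mathlib-K2Liu-p02 (g8), Track B «K2-LIT» ∕ hLiu418
#184♮, Road I v3 («uniqueness road» for #42F′), unit U5 «THE CLOSE», STEP C «THE ASSEMBLY» — the #42F′ TOP, EDITION 3 «THETA DATUM OF RECORD» (LEAD F0P6-plan (g14) BATCH #51 (2)
2026-09-04T16:03:27Z; K2E5-plan (g7) 16:16:09Z «U5-C TOP hypothesis-first GO»; binder sheet `K2/K2E5-plan/g7/SIGS-RoadI-v3.md` §2 U4, U4b, U5).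
-/
import Summits.HodgeConjecture.HodgeConjecture.Theorems.K2LiuFirstTermIdentityAssemblyRigidity  -- ED. 2 (p861964): `‹#41› → ‹FACE-I› → ‹#42F′ :711›`
import Summits.HodgeConjecture.HodgeConjecture.Theorems.K2LiuRankOneCoefficientComparison      -- ★ U2 p858028: `rankOneCoefficientComparison`
import Summits.HodgeConjecture.HodgeConjecture.Theorems.K2LiuLineThetaSideWitness               -- ★ p858449 (K2Liu-p02 g5): the theta datum of record, hypothesis-free
import HarnessLib

/-!
# K2_Liu road (hLiu418 = stmt-HodgeConjecture-24832), Road I v3, unit U5 «THE CLOSE», STEP C: THE #42F′ TOP — EDITION 3 «THETA DATUM OF RECORD»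
# `‹#41› → ‹FACE-T› → ‹#42F′ :711 verbatim›` — the theta datum `(hρ, μW, fw)` is the WITNESS OF RECORD and `hne` is PAID from ★ U4b

Cell `pub/hodgecm-mathlib` (D-0151), Track B, build stream 29.  EDITION 2 (`K2LiuFirstTermIdentityAssemblyRigidity.firstTermIdentityOnGenerators_of_rigidityInputs`)
derives socket #42F′ from socket #41 and FACE-I: per frame SOME theta datum `(a′, hρ, μW, fw)` and, per rigidity domain and admissible `T₁`, the eleven inputs of ★ U2
`rankOneRigidity` at `T₂ = B ∘ 𝓣`.  THIS EDITION pins the theta datum to the WITNESS OF RECORD ★ `K2LiuLineThetaSideWitness.exists_lineThetaSide_witness` (K2Liu-p02 (g5):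
Weil majorants ★ `hasThetaMajorants_pairRep_dD`, `μW := Measure.haar` on the compact abelian group `[U(⟨a′⟩)]` — finite, `U(⟨a′⟩)(𝔸)`-invariant, CHARGING OPEN SETS; cf. ★
`K2LiuLineQuotientMeasure.exists_lineQuotientMeasure`, K2Liu-p24 —, a character `χ` of `U(⟨a′⟩)(𝔸)` trivial on `U(⟨a′⟩)(L⁺)` with its descended weight `fw` and
eigen-law, and `Φ′₀` with `B(a′, hρ, μW, Φ′₀, fw)(1) ≠ 0` = ★ U4b `K2LiuLineThetaNonvanishing.exists_doubledLineThetaLift_one_ne_zero` with its seven majorants discharged)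
and PAYS `hne` — the **THETA-INPUT FACE**

* **FACE-T** = the frame prefix, `∃ a′` (the line: Witt complement of `V′` — by value until the frame letter), then FOR EVERY theta datum `(hρ, μW, χ, fw)` on `⟨a′⟩` with
  the seven properties of the witness (finite ∕ invariant ∕ open-pos ∕ `χ` rational-trivial ∕ continuous ∕ `fw` descends `χ` ∕ eigen-law `fw(u • q) = χ u · fw q` — the
  input of ★ U4 `doubledLineThetaLift_pairRep_inr_of_eigen`), on every rigidity domain `D_V` and for every admissible `T₁`: the carrier `𝓣` (now also ONTO — ★ (P3)
  `K2LiuIkedaMapOfRecord.ikedaMapOfRecord_surjective` pays it for `𝓣 := 𝓡`), `T₂ = B ∘ 𝓣`, the class `P` and the rigidity data with ★ `rankOneRigidity`'s inputs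
  `hdet hT₁ hT₂ h2₁ h2₂ hfin h₁ h₂` BYTES VERBATIM — and NO `hne`.

* **`firstTermIdentityOnGenerators_of_thetaInputs : ‹#41 :289 verbatim› → ‹FACE-T› → ‹#42F′ :711–771 verbatim›`** := ED. 2 after FACE-I from FACE-T: take the
  witness of record on the line `a′`; `hne : coeff β₀ ∘ T₂ ≠ 0` BY NAME — if it vanished, ★ U2 `rankOneCoefficientComparison` (the pair `(coeff·∘T₂, coeff·∘T₂)`, constant
  `c₀ = 0`, transport `hT₂`, rank-2 vanishing `h2₂`, class `hfin`) kills EVERY non-zero hermitian coefficient of every `T₂ x`, so `hdet` gives `T₂ = 0`; but `𝓣` is onto,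
  so `T₂ x₀ = B(Φ′₀)` for some `x₀`, and `B(Φ′₀)(1) ≠ 0` (★ U4b).

REMAINING BY VALUE after ED. 3: the line `a′` (frame letter: ★ `K2LiuHermitianWittFrame.exists_wittFrame_three` ∕ ★ `K2LiuWittLineEmbedding.exists_lineFrame`), the carrier
`𝓣 := 𝓡` with (P3), `P := P_k` + `coeff := fourierCoeffDelta` on the class with `hdet` (★ HolType §1–§2 + ★ `exists_tubeFrame_arch₃` + Haar data), `hP₁` ((T) ★ ∕ (L) ★ ∕
(CR)), `hP₂`, `hT₁ hT₂` (U3), `h2₁` (F-T1-coinv: ★ LineFactorisation + (α_w)∕(σ) + U1-glob, ★ U2a), `h2₂` (★ U4 + ★ U2a), `hfin` (★ U2c-fin + signs), `h₁ h₂` (★ Coinvariance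
§3 + ★ U2e + (F4)), (R-gen).  No statement of any socket is changed; nothing here closes #41 or #42F′.

No definition, no instance, no notation, no named-fact hypothesis, no `sorry`; axioms ⊆ {propext, Classical.choice, Quot.sound}.  HONEST LABEL: HC_CM is
proved only modulo the 7 printed citations (2 remaining named inputs: hLiu418 = stmt-HodgeConjecture-24832, h413 = stmt-HodgeConjecture-24833) until rung 0
closes; this file is a `--supports stmt-HodgeConjecture-24832` helper and moves no counter.

References: [KudlaRallis1994] S. Kudla, S. Rallis, Ann. of Math. 140 (1994) §1 Thm. 1.1, §3; [Rallis1984] S. Rallis, Compositio Math. 51 (1984) §§1–2, §4;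
[Li1992] J.-S. Li, J. reine angew. Math. 428 (1992) p. 181; [GanQiuTakeda2014] W. T. Gan, Y. Qiu, S. Takeda, Invent. Math. 198 (2014) §1.3, §2.7–2.8, §7 Thm. 20 (i);
[Weil1964] A. Weil, Acta Math. 111 (1964) Chap. III n° 41 Lemme 5, Thm 6; [Omeara1963] O. T. O'Meara (1963) §65D Thm. 65:23; [Liu2021] Y. Liu, Camb. J. Math. 9
(2021) App. B (B.7), Lem. B.9–B.12, proof of Prop. B.8 pp. 103–106.
-/

set_option autoImplicit false
set_option linter.dupNamespace false

noncomputable section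

open scoped Matrix Topology TensorProduct SchwartzMap Classical  -- `Classical`: the `Fintype` of real ∕ complex places inside `mixedSpace (L⁺)` (as in ★ U2f)
open NumberField NumberField.mixedEmbedding IsDedekindDomain MeasureTheory Filter

namespace Summit.HodgeConjecture.HodgeConjecture.Cruxes.HLiu418.K2LiuFirstTermIdentityAssemblyTheta

open Literature.NumberTheory.Automorphic Literature.NumberTheory.Automorphic.UnitaryGroup Literature.NumberTheory.GaloisRepresentations
open Literature.NumberTheory.GelbartRogawski1991 Literature.NumberTheory.GelbartRogawski1991.GRConstruction
open Literature.NumberTheory.GelbartRogawski1991.UnitaryDualPair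
open Literature.NumberTheory.K2Lit.SiegelDoubled Literature.NumberTheory.K2Lit.DoubledLineTheta
open Literature.NumberTheory.Automorphic.IdeleClassGroup
open Literature.NumberTheory.Automorphic.Liu2021
open Literature.NumberTheory.Automorphic.Liu2021.Def411WeilCarriers
open Literature.NumberTheory.Automorphic.Liu2021.Def411WeilCarriersDoubling
open Literature.NumberTheory.Weil1964
open Literature.RepresentationTheory.Liu2021
open Literature.RepresentationTheory.HarrisKudlaSweet1996 (IsSplittingChar)
open Summit.HodgeConjecture.HodgeConjecture.Cruxes.HLiu418.K2LiuFirstTermResidueFormDefs (resNorm)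
open Summit.HodgeConjecture.HodgeConjecture.Cruxes.HLiu418.K2LiuFirstTermIdentityAssemblyRigidity (firstTermIdentityOnGenerators_of_rigidityInputs)
open Summit.HodgeConjecture.HodgeConjecture.Cruxes.HLiu418.K2LiuRankOneCoefficientComparison (rankOneCoefficientComparison)
open Summit.HodgeConjecture.HodgeConjecture.Cruxes.HLiu418.K2LiuLineThetaSideWitness (exists_lineThetaSide_witness)

set_option maxHeartbeats 4000000 in -- #41 by value + FACE-T (theta-datum ∀-package + carrier telescope); measured: 2400000 still times out at `whnf` on the STATEMENT (ED. 1∕2 needed 1600000)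
/-- **U5 STEP C, EDITION 3 — THE #42F′ TOP WITH THE THETA DATUM OF RECORD AND `hne` PAID: `‹#41› → ‹FACE-T› → ‹#42F′›`.**  Conclusion = the statement of
`sig_K2LiuFirstTermIdentityOnGenerators` (U6 ED. 12 :711–771) BY VALUE, bytes verbatim; hypotheses = socket #41 (U6 ED. 12 :289) BY VALUE and **FACE-T** (module
docstring): the frame prefix, the line `a′`, then FOR EVERY theta datum `(hρ, μW, χ, fw)` on `⟨a′⟩` with the seven properties of ★ `exists_lineThetaSide_witness`, per rigidity
domain and admissible `T₁` the carrier `𝓣` (onto), `T₂ = B ∘ 𝓣`, the class `P` and ★ `rankOneRigidity`'s inputs `hdet hT₁ hT₂ h2₁ h2₂ hfin h₁ h₂` (no `hne`).  Proof: ED. 2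
after the witness of record (★ p858449) on the line `a′`; `hne` by contradiction through ★ `rankOneCoefficientComparison` at the pair `(coeff·∘T₂, coeff·∘T₂)`, `c₀ = 0`
(all non-zero hermitian coefficients of `T₂` would vanish, so `T₂ = 0` by `hdet`, against `B(Φ′₀)(1) ≠ 0` and `𝓣` onto).  Nothing here closes #41 or #42F′.
[cite: KudlaRallis1994, §1 Thm. 1.1, §3] [cite: Rallis1984, §4] [cite: GanQiuTakeda2014, §2.7–2.8, §7 Thm. 20 (i)] [cite: Weil1964, Chap. III n° 41 Thm 6 p. 193]
[cite: Liu2021, App. B (B.7) p. 104, proof of Prop. B.8 pp. 103–106] -/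
theorem firstTermIdentityOnGenerators_of_thetaInputs
    (h41 : ∀ (L : Type) [Field L] [NumberField L] [IsCMField L] {n : ℕ} (e : Fin 2 × Fin 1 ≃ Fin n)
      (dV : Fin 2 → L) (hdV : ∀ i, IsCMField.complexConj L (dV i) = dV i) (hdV0 : ∀ i, dV i ≠ 0)
      (dW : Fin 1 → L) (hdW : ∀ i, IsCMField.complexConj L (dW i) = dW i) (hdW0 : ∀ i, dW i ≠ 0)
      (lam : Literature.NumberTheory.Automorphic.IdeleClassGroup L →ₜ* Circle) (hlam : IsConjugateSymplectic L lam),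
      HasWeight L lam 1 →
      ∀ (𝒦 : IwasawaDatum L e dV hdV dW hdW) (_h𝒦 : 𝒦.IsStd) (f : ℂ → HA L e dV hdV dW hdW → ℂ),
        IsStandardSectionFamily 𝒦 (toHeckeCharacter L lam⁻¹) f → (∀ s, Continuous (f s)) →
      ∃ (P : Finset ℂ) (Es : ℂ → HA L e dV hdV dW hdW → ℂ),
        (∀ h : HA L e dV hdV dW hdW, DifferentiableOn ℂ (fun s => Es s h) {s : ℂ | 0 < s.re}) ∧
        (∀ s : ℂ, 0 < s.re → Continuous (Es s)) ∧
        (∀ s : ℂ, 0 < s.re → ∀ (γ : ratH L e dV hdV dW hdW) (h : HA L e dV hdV dW hdW),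
          Es s ((γ : HA L e dV hdV dW hdW) * h) = Es s h) ∧
        (∀ (s : ℂ) (h : HA L e dV hdV dW hdW), (n : ℝ) / 2 < s.re →
          Es s h = (∏ p ∈ P, (s - p)) * eisensteinFamilyDelta L e dV hdV dW hdW f s h) ∧
        (∀ z : ℂ, 0 < z.re → ∃ C A r : ℝ, 0 < r ∧ ∀ s : ℂ, dist s z < r → ∀ h : HA L e dV hdV dW hdW,
          ‖Es s h‖ ≤ C * adelicHeightGL (n + n) L (h : GL (Fin (n + n)) (AdeleRing (𝓞 L) L)) ^ A))
    (hT : ∀ (L : Type) [Field L] [NumberField L] [IsCMField L] {n : ℕ} (e : Fin 2 × Fin 1 ≃ Fin n)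
      (dV : Fin 2 → L) (hdV : ∀ i, IsCMField.complexConj L (dV i) = dV i) (hdV0 : ∀ i, dV i ≠ 0)
      (dW : Fin 1 → L) (hdW : ∀ i, IsCMField.complexConj L (dW i) = dW i) (hdW0 : ∀ i, dW i ≠ 0)
      (lam : Literature.NumberTheory.Automorphic.IdeleClassGroup L →ₜ* Circle) (hlam : IsConjugateSymplectic L lam),
      HasWeight L lam 1 →
      ∀ {M' n' : ℕ} (eW : Fin 1 × Fin 3 ≃ Fin M') (e' : Fin 2 × Fin M' ≃ Fin n')
        (dV' : Fin 3 → L) (hdV' : ∀ k, IsCMField.complexConj L (dV' k) = dV' k) (hdV'0 : ∀ k, dV' k ≠ 0)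
        (χb : HeckeCharacter L) (hχbu : χb.IsUnitary) (hχbs : Literature.RepresentationTheory.HarrisKudlaSweet1996.IsSplittingChar L 1 χb)
        (α : UnitaryGroup.adelicOne (Fp L) L (IsCMField.complexConj L) →* ℂˣ) (hα : Continuous α)
        (hαrat : ∀ u : UnitaryGroup.adelicOne (Fp L) L (IsCMField.complexConj L),
          (u : Literature.NumberTheory.GaloisRepresentations.ideleGroup L) ∈ Literature.NumberTheory.GaloisRepresentations.principalIdeles L → α u = 1)
        (_hχD : χb ^ 3 * DoubledWeilDetTwist.ratioHecke L α hα hαrat = toHeckeCharacter L lam⁻¹)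
        (𝒦 : IwasawaDatum L e dV hdV dW hdW) (_h𝒦 : 𝒦.IsStd)
      {n'' : ℕ} (e₁ : Fin (n + n) × Fin 1 ≃ Fin n''),
      ∃ (a' : (↥(maximalRealSubfield L))ˣ),
        -- FACE-T: for EVERY theta datum on the line `a′` with the properties of the witness of record (★ `K2LiuLineThetaSideWitness.exists_lineThetaSide_witness`:
        -- Weil majorants, a finite invariant measure charging open sets, a character weight with its eigen-law) …
        ∀ (hρ : HasThetaMajorants fun
          (p : ↥(UnitaryGroup.adelic (↥(maximalRealSubfield L)) L (IsCMField.complexConj L) (n + n) (Matrix.diagonal (dD L e dV hdV dW hdW))) ×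
            ↥(UnitaryGroup.adelic (↥(maximalRealSubfield L)) L (IsCMField.complexConj L) 1 (JW (↥(maximalRealSubfield L)) L a')))
          (Ψ : piSchwartzBruhat (↥(maximalRealSubfield L)) (Fin n'')) =>
            pairRep (↥(maximalRealSubfield L)) L (IsCMField.complexConj L) (n + n) 1 e₁ (Matrix.diagonal (dD L e dV hdV dW hdW)) (JW (↥(maximalRealSubfield L)) L a')
              (chiSplittingLine L e₁ (dD L e dV hdV dW hdW) (dD_conj L e dV hdV dW hdW) (dD_ne_zero L e dV hdV dW hdW hdV0 hdW0)
                (toHeckeCharacter L lam⁻¹) (isUnitary_toHeckeCharacter L lam⁻¹)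
                ((isOscillatorChar_toHeckeCharacter_iff lam⁻¹).mpr (K2LiuConjugateSymplecticInv.IsConjugateSymplectic.inv hlam)) (TW (↥(maximalRealSubfield L)) a')
                (isUnit_det_TW (↥(maximalRealSubfield L)) a') (JW (↥(maximalRealSubfield L)) L a') (JW_eq (↥(maximalRealSubfield L)) L a'))
              p Ψ)
        (μW : @Measure (↥(UnitaryGroup.adelic (↥(maximalRealSubfield L)) L (IsCMField.complexConj L) 1 (JW (↥(maximalRealSubfield L)) L a')) ⧸
          (UnitaryGroup.toAdelic (↥(maximalRealSubfield L)) L (IsCMField.complexConj L) 1 (JW (↥(maximalRealSubfield L)) L a')).range) (borel _))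
        (χ : ↥(UnitaryGroup.adelic (↥(maximalRealSubfield L)) L (IsCMField.complexConj L) 1 (JW (↥(maximalRealSubfield L)) L a')) →* ℂˣ)
        (fw : C(↥(UnitaryGroup.adelic (↥(maximalRealSubfield L)) L (IsCMField.complexConj L) 1 (JW (↥(maximalRealSubfield L)) L a')) ⧸
          (UnitaryGroup.toAdelic (↥(maximalRealSubfield L)) L (IsCMField.complexConj L) 1 (JW (↥(maximalRealSubfield L)) L a')).range, ℂ)),
        @IsFiniteMeasure _ (borel _) μW →
        @SMulInvariantMeasure
          ↥(UnitaryGroup.adelic (↥(maximalRealSubfield L)) L (IsCMField.complexConj L) 1 (JW (↥(maximalRealSubfield L)) L a'))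
          (↥(UnitaryGroup.adelic (↥(maximalRealSubfield L)) L (IsCMField.complexConj L) 1 (JW (↥(maximalRealSubfield L)) L a')) ⧸
            (UnitaryGroup.toAdelic (↥(maximalRealSubfield L)) L (IsCMField.complexConj L) 1 (JW (↥(maximalRealSubfield L)) L a')).range)
          _ (borel _) μW →
        @Measure.IsOpenPosMeasure (↥(UnitaryGroup.adelic (↥(maximalRealSubfield L)) L (IsCMField.complexConj L) 1 (JW (↥(maximalRealSubfield L)) L a')) ⧸
            (UnitaryGroup.toAdelic (↥(maximalRealSubfield L)) L (IsCMField.complexConj L) 1 (JW (↥(maximalRealSubfield L)) L a')).range) _ (borel _) μW →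
        (∀ γ ∈ (UnitaryGroup.toAdelic (↥(maximalRealSubfield L)) L (IsCMField.complexConj L) 1 (JW (↥(maximalRealSubfield L)) L a')).range, χ γ = 1) →
        (Continuous fun u => ((χ u : ℂˣ) : ℂ)) →
        (∀ u : ↥(UnitaryGroup.adelic (↥(maximalRealSubfield L)) L (IsCMField.complexConj L) 1 (JW (↥(maximalRealSubfield L)) L a')), fw (QuotientGroup.mk u) = ((χ u : ℂˣ) : ℂ)) →
        (∀ (u : ↥(UnitaryGroup.adelic (↥(maximalRealSubfield L)) L (IsCMField.complexConj L) 1 (JW (↥(maximalRealSubfield L)) L a')))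
          (q : ↥(UnitaryGroup.adelic (↥(maximalRealSubfield L)) L (IsCMField.complexConj L) 1 (JW (↥(maximalRealSubfield L)) L a')) ⧸
            (UnitaryGroup.toAdelic (↥(maximalRealSubfield L)) L (IsCMField.complexConj L) 1 (JW (↥(maximalRealSubfield L)) L a')).range),
          fw (u • q) = ((χ u : ℂˣ) : ℂ) * fw q) →
        -- … on every rigidity domain `D_V` and for every admissible `T₁`: ★ U2 `rankOneRigidity`'s inputs at `T₂ := B ∘ 𝓣`, `𝓣` ONTO, WITHOUT `hne`
        ∀ (V : Submodule ℂ 𝓢(((Fin (n' + n')) → mixedSpace (Fp L)), ℂ)), FiniteDimensional ℂ V →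
          (∀ ainf : UnitaryGroup.arch (Fp L) L (IsCMField.complexConj L) (n + n) (hermD L e dV hdV dW hdW),
            (UnitaryGroup.archToAdelic (Fp L) L (IsCMField.complexConj L) (n + n) (hermD L e dV hdV dW hdW) ainf : HA L e dV hdV dW hdW) ∈ 𝒦.K →
            ∀ a ∈ V, ∃ a'' ∈ V, ∀ f : FinSB (Fp L) (Fin (n' + n')),
              adelicMpCont.omega (Fp L) (Fin (n' + n')) (gramDA L e' dV hdV (tensorFrame L dW eW dV') (tensorFrame_real L dW hdW eW dV' hdV'))
                  ((doubledWeilRep L e' dV hdV hdV0 (tensorFrame L dW eW dV') (tensorFrame_real L dW hdW eW dV' hdV')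
                        (tensorFrame_ne_zero L dW eW dV' hdW0 hdV'0) χb hχbu hχbs)
                    (tensorEmb L e dV hdV dW hdW eW e' dV' hdV'
                      (UnitaryGroup.archToAdelic (Fp L) L (IsCMField.complexConj L) (n + n) (hermD L e dV hdV dW hdW) ainf)))
                  (piSchwartzBruhatEquiv (Fp L) (Fin (n' + n')) (a ⊗ₜ[ℂ] f)) =
                piSchwartzBruhatEquiv (Fp L) (Fin (n' + n')) (a'' ⊗ₜ[ℂ] f)) →
          ∀ (T₁ : ↥(Submodule.span ℂ {x : piSchwartzBruhat (Fp L) (Fin (n' + n')) |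
              ∃ a ∈ V, ∃ f : FinSB (Fp L) (Fin (n' + n')), x = piSchwartzBruhatEquiv (Fp L) (Fin (n' + n')) (a ⊗ₜ[ℂ] f)}) →ₗ[ℂ]
              (HA L e dV hdV dW hdW → ℂ)),
            -- (a) ★ 0c: the value on ANY pole-cleared continuation of `E^Δ(s; g_x)`
            (∀ (x : ↥(Submodule.span ℂ {x : piSchwartzBruhat (Fp L) (Fin (n' + n')) |
                ∃ a ∈ V, ∃ f : FinSB (Fp L) (Fin (n' + n')), x = piSchwartzBruhatEquiv (Fp L) (Fin (n' + n')) (a ⊗ₜ[ℂ] f)}))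
              (Pg : Finset ℂ) (Eg : ℂ → HA L e dV hdV dW hdW → ℂ),
              (∀ h : HA L e dV hdV dW hdW, DifferentiableOn ℂ (fun s => Eg s h) {s : ℂ | 0 < s.re}) →
              (∀ (s : ℂ) (h : HA L e dV hdV dW hdW), (n : ℝ) / 2 < s.re →
                Eg s h = (∏ p ∈ Pg, (s - p)) * eisensteinFamilyDelta L e dV hdV dW hdW
                  (fun s₁ h₁ => ((DoubledWeilDetTwist.detChar L e dV hdV hdV0 dW hdW hdW0 α h₁ : ℂˣ) : ℂ) *
                    stdExtension 𝒦 ((((3 : ℕ) : ℂ) - (n : ℂ)) / 2)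
                      (swSectionTensor L e dV hdV dW hdW eW e' dV' hdV' hdV0 hdW0 hdV'0
                        (doubledWeilRep L e' dV hdV hdV0 (tensorFrame L dW eW dV') (tensorFrame_real L dW hdW eW dV' hdV')
                          (tensorFrame_ne_zero L dW eW dV' hdW0 hdV'0) χb hχbu hχbs)
                        (x : piSchwartzBruhat (Fp L) (Fin (n' + n')))) s₁ h₁) s h) →
              T₁ x = resNorm Pg Eg) →
            -- (b) ★ 0c: `T₁ x` IS the residue form of a continuation with ALL FIVE clauses of #41
            (∀ x : ↥(Submodule.span ℂ {x : piSchwartzBruhat (Fp L) (Fin (n' + n')) |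
                ∃ a ∈ V, ∃ f : FinSB (Fp L) (Fin (n' + n')), x = piSchwartzBruhatEquiv (Fp L) (Fin (n' + n')) (a ⊗ₜ[ℂ] f)}),
              ∃ (P : Finset ℂ) (Es : ℂ → HA L e dV hdV dW hdW → ℂ),
                ((∀ h : HA L e dV hdV dW hdW, DifferentiableOn ℂ (fun s => Es s h) {s : ℂ | 0 < s.re}) ∧
                (∀ s : ℂ, 0 < s.re → Continuous (Es s)) ∧
                (∀ s : ℂ, 0 < s.re → ∀ (γ : ratH L e dV hdV dW hdW) (h : HA L e dV hdV dW hdW),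
                  Es s ((γ : HA L e dV hdV dW hdW) * h) = Es s h) ∧
                (∀ (s : ℂ) (h : HA L e dV hdV dW hdW), (n : ℝ) / 2 < s.re →
                  Es s h = (∏ p ∈ P, (s - p)) * eisensteinFamilyDelta L e dV hdV dW hdW
                    (fun s₁ h₁ => ((DoubledWeilDetTwist.detChar L e dV hdV hdV0 dW hdW hdW0 α h₁ : ℂˣ) : ℂ) *
                      stdExtension 𝒦 ((((3 : ℕ) : ℂ) - (n : ℂ)) / 2)
                        (swSectionTensor L e dV hdV dW hdW eW e' dV' hdV' hdV0 hdW0 hdV'0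
                          (doubledWeilRep L e' dV hdV hdV0 (tensorFrame L dW eW dV') (tensorFrame_real L dW hdW eW dV' hdV')
                            (tensorFrame_ne_zero L dW eW dV' hdW0 hdV'0) χb hχbu hχbs)
                          (x : piSchwartzBruhat (Fp L) (Fin (n' + n')))) s₁ h₁) s h) ∧
                (∀ z : ℂ, 0 < z.re → ∃ C A r : ℝ, 0 < r ∧ ∀ s : ℂ, dist s z < r → ∀ h : HA L e dV hdV dW hdW,
                  ‖Es s h‖ ≤ C * adelicHeightGL (n + n) L (h : GL (Fin (n + n)) (AdeleRing (𝓞 L) L)) ^ A)) ∧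
                T₁ x = resNorm P Es) →
            -- (c) ★ 0c: continuous, left-`H(L⁺)`-invariant, of moderate growth
            (∀ x, Continuous (T₁ x)) →
            (∀ x (γ : ratH L e dV hdV dW hdW) (h : HA L e dV hdV dW hdW), T₁ x ((γ : HA L e dV hdV dW hdW) * h) = T₁ x h) →
            (∀ x, ∃ C A : ℝ, ∀ h : HA L e dV hdV dW hdW,
              ‖T₁ x h‖ ≤ C * adelicHeightGL (n + n) L (h : GL (Fin (n + n)) (AdeleRing (𝓞 L) L)) ^ A) →
            ∃ (𝓣 : ↥(Submodule.span ℂ {x : piSchwartzBruhat (Fp L) (Fin (n' + n')) |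
                ∃ a ∈ V, ∃ f : FinSB (Fp L) (Fin (n' + n')), x = piSchwartzBruhatEquiv (Fp L) (Fin (n' + n')) (a ⊗ₜ[ℂ] f)}) →ₗ[ℂ]
                  piSchwartzBruhat (↥(maximalRealSubfield L)) (Fin n''))
              (T₂ : ↥(Submodule.span ℂ {x : piSchwartzBruhat (Fp L) (Fin (n' + n')) |
                  ∃ a ∈ V, ∃ f : FinSB (Fp L) (Fin (n' + n')), x = piSchwartzBruhatEquiv (Fp L) (Fin (n' + n')) (a ⊗ₜ[ℂ] f)}) →ₗ[ℂ] (HA L e dV hdV dW hdW → ℂ)),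
              -- the theta side IS the doubled line theta lift after the carrier `𝓣` (★ D8 at `λ⁻¹`, bytes of #42F′'s conclusion)
              (∀ x (h : HA L e dV hdV dW hdW), T₂ x h = @doubledLineThetaLift L _ _ _ 2 1 n e dV hdV dW hdW n'' e₁ hdV0 hdW0 lam⁻¹
                  (K2LiuConjugateSymplecticInv.IsConjugateSymplectic.inv hlam) a' hρ (borel _) μW (𝓣 x) fw h) ∧
              -- the carrier is ONTO (★ `K2LiuIkedaMapOfRecord.ikedaMapOfRecord_surjective`), so the theta side reaches the witness `Φ′` of ★ U4b
              Function.Surjective 𝓣 ∧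
              -- the value class `P ∋ T₁ x, T₂ x` and the rigidity data: ★ U2 `rankOneRigidity`'s binders at `N := ↥P`, `M := H(𝔸) → ℂ`, BY VALUE
              ∃ (P : Submodule ℂ (HA L e dV hdV dW hdW → ℂ)) (hP₁ : ∀ x, T₁ x ∈ P) (hP₂ : ∀ x, T₂ x ∈ P)
                (coeff : Matrix (Fin 2) (Fin 2) L → ↥P →ₗ[ℂ] (HA L e dV hdV dW hdW → ℂ))
                (R : Matrix (Fin 2) (Fin 2) L → (HA L e dV hdV dW hdW → ℂ) →ₗ[ℂ] (HA L e dV hdV dW hdW → ℂ))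
                (S : Matrix (Fin 2) (Fin 2) L → ↥(Submodule.span ℂ {x : piSchwartzBruhat (Fp L) (Fin (n' + n')) |
                    ∃ a ∈ V, ∃ f : FinSB (Fp L) (Fin (n' + n')), x = piSchwartzBruhatEquiv (Fp L) (Fin (n' + n')) (a ⊗ₜ[ℂ] f)}) →ₗ[ℂ]
                  ↥(Submodule.span ℂ {x : piSchwartzBruhat (Fp L) (Fin (n' + n')) |
                      ∃ a ∈ V, ∃ f : FinSB (Fp L) (Fin (n' + n')), x = piSchwartzBruhatEquiv (Fp L) (Fin (n' + n')) (a ⊗ₜ[ℂ] f)}))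
                (lam₀ : ↥(Submodule.span ℂ {x : piSchwartzBruhat (Fp L) (Fin (n' + n')) |
                    ∃ a ∈ V, ∃ f : FinSB (Fp L) (Fin (n' + n')), x = piSchwartzBruhatEquiv (Fp L) (Fin (n' + n')) (a ⊗ₜ[ℂ] f)}) →ₗ[ℂ] (HA L e dV hdV dW hdW → ℂ)) (c₁ c₂ : ℂ),
                -- `hdet` (Hol.3c): a member of `P` all of whose non-zero hermitian coefficients vanish is `0`
                (∀ y : ↥P, (∀ β : Matrix (Fin 2) (Fin 2) L, (β.map (IsCMField.complexConj L))ᵀ = β → β ≠ 0 → coeff β y = 0) → y = 0) ∧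
                -- `hT₁` `hT₂` (U3): automorphy of the coefficients under the rational Levi
                (∀ γ : Matrix (Fin 2) (Fin 2) L, IsUnit γ.det → ∀ β : Matrix (Fin 2) (Fin 2) L,
                  coeff ((γ.map (IsCMField.complexConj L))ᵀ * β * γ) ∘ₗ LinearMap.codRestrict P T₁ hP₁ =
                    R γ ∘ₗ (coeff β ∘ₗ LinearMap.codRestrict P T₁ hP₁) ∘ₗ S γ) ∧
                (∀ γ : Matrix (Fin 2) (Fin 2) L, IsUnit γ.det → ∀ β : Matrix (Fin 2) (Fin 2) L,
                  coeff ((γ.map (IsCMField.complexConj L))ᵀ * β * γ) ∘ₗ LinearMap.codRestrict P T₂ hP₂ =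
                    R γ ∘ₗ (coeff β ∘ₗ LinearMap.codRestrict P T₂ hP₂) ∘ₗ S γ) ∧
                -- `h2₁` `h2₂` (U2a through F-T1-coinv ∕ U4): no coefficients at non-degenerate hermitian `β`
                (∀ β : Matrix (Fin 2) (Fin 2) L, (β.map (IsCMField.complexConj L))ᵀ = β → β.det ≠ 0 →
                  coeff β ∘ₗ LinearMap.codRestrict P T₁ hP₁ = 0) ∧
                (∀ β : Matrix (Fin 2) (Fin 2) L, (β.map (IsCMField.complexConj L))ᵀ = β → β.det ≠ 0 →
                  coeff β ∘ₗ LinearMap.codRestrict P T₂ hP₂ = 0) ∧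
                -- `hfin` (U2c-fin + archimedean signs): a surviving rank-one index lies in the class of the line `a′`
                (∀ (b : (↥(maximalRealSubfield L))ˣ) (u : Fin 2 → L), (∃ k, u k = 1) →
                  (coeff (algebraMap ↥(maximalRealSubfield L) L b • Matrix.vecMulVec (⇑(IsCMField.complexConj L) ∘ u) u) ∘ₗ
                        LinearMap.codRestrict P T₁ hP₁ ≠ 0 ∨
                    coeff (algebraMap ↥(maximalRealSubfield L) L b • Matrix.vecMulVec (⇑(IsCMField.complexConj L) ∘ u) u) ∘ₗ
                        LinearMap.codRestrict P T₂ hP₂ ≠ 0) →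
                  (∀ v : HeightOneSpectrum (𝓞 ↥(maximalRealSubfield L)),
                      locF ↥(maximalRealSubfield L) (imagUnitSq L) b v = locF ↥(maximalRealSubfield L) (imagUnitSq L) a' v) ∧
                    ∀ ρ : ↥(maximalRealSubfield L) →+* ℝ, 0 < ρ ((b : ↥(maximalRealSubfield L)) * ((a' : ↥(maximalRealSubfield L)))⁻¹)) ∧
                -- `h₁` `h₂` (U2b ∕ U2e): the LINE of admissible functionals at `β₀ = diag(a′, 0)` (`hne` is PAID inside from ★ U4b, ED. 3)
                coeff (Matrix.diagonal ![algebraMap ↥(maximalRealSubfield L) L a', 0]) ∘ₗ LinearMap.codRestrict P T₁ hP₁ = c₁ • lam₀ ∧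
                coeff (Matrix.diagonal ![algebraMap ↥(maximalRealSubfield L) L a', 0]) ∘ₗ LinearMap.codRestrict P T₂ hP₂ = c₂ • lam₀) :
    -- ‹#42F′ :711–771 verbatim›
    ∀ (L : Type) [Field L] [NumberField L] [IsCMField L] {n : ℕ} (e : Fin 2 × Fin 1 ≃ Fin n)
      (dV : Fin 2 → L) (hdV : ∀ i, IsCMField.complexConj L (dV i) = dV i) (hdV0 : ∀ i, dV i ≠ 0)
      (dW : Fin 1 → L) (hdW : ∀ i, IsCMField.complexConj L (dW i) = dW i) (hdW0 : ∀ i, dW i ≠ 0)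
      (lam : Literature.NumberTheory.Automorphic.IdeleClassGroup L →ₜ* Circle) (hlam : IsConjugateSymplectic L lam),
      HasWeight L lam 1 →
      ∀ {M' n' : ℕ} (eW : Fin 1 × Fin 3 ≃ Fin M') (e' : Fin 2 × Fin M' ≃ Fin n')
        (dV' : Fin 3 → L) (hdV' : ∀ k, IsCMField.complexConj L (dV' k) = dV' k) (hdV'0 : ∀ k, dV' k ≠ 0)
        (χb : HeckeCharacter L) (hχbu : χb.IsUnitary) (hχbs : Literature.RepresentationTheory.HarrisKudlaSweet1996.IsSplittingChar L 1 χb)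
        (α : UnitaryGroup.adelicOne (Fp L) L (IsCMField.complexConj L) →* ℂˣ) (hα : Continuous α)
        (hαrat : ∀ u : UnitaryGroup.adelicOne (Fp L) L (IsCMField.complexConj L),
          (u : Literature.NumberTheory.GaloisRepresentations.ideleGroup L) ∈ Literature.NumberTheory.GaloisRepresentations.principalIdeles L → α u = 1)
        (_hχD : χb ^ 3 * DoubledWeilDetTwist.ratioHecke L α hα hαrat = toHeckeCharacter L lam⁻¹)
        (𝒦 : IwasawaDatum L e dV hdV dW hdW) (_h𝒦 : 𝒦.IsStd)
        (Φ : piSchwartzBruhat (Fp L) (Fin (n' + n')))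
        (_hΦ : FiniteDimensional ℂ (Submodule.span ℂ (Set.range fun k : 𝒦.K =>
          adelicMpCont.omega (Fp L) (Fin (n' + n')) (gramDA L e' dV hdV (tensorFrame L dW eW dV') (tensorFrame_real L dW hdW eW dV' hdV'))
            ((doubledWeilRep L e' dV hdV hdV0 (tensorFrame L dW eW dV') (tensorFrame_real L dW hdW eW dV' hdV')
                    (tensorFrame_ne_zero L dW eW dV' hdW0 hdV'0) χb hχbu hχbs)
              (tensorEmb L e dV hdV dW hdW eW e' dV' hdV' (k : HA L e dV hdV dW hdW))) Φ)))
        (Pg : Finset ℂ) (Eg : ℂ → HA L e dV hdV dW hdW → ℂ),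
        (∀ h : HA L e dV hdV dW hdW, DifferentiableOn ℂ (fun s => Eg s h) {s : ℂ | 0 < s.re}) →
        (∀ (s : ℂ) (h : HA L e dV hdV dW hdW), (n : ℝ) / 2 < s.re →
          Eg s h = (∏ p ∈ Pg, (s - p)) * eisensteinFamilyDelta L e dV hdV dW hdW
            (fun s₁ h₁ => ((DoubledWeilDetTwist.detChar L e dV hdV hdV0 dW hdW hdW0 α h₁ : ℂˣ) : ℂ) *
              stdExtension 𝒦 ((((3 : ℕ) : ℂ) - (n : ℂ)) / 2)
                (swSectionTensor L e dV hdV dW hdW eW e' dV' hdV' hdV0 hdW0 hdV'0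
                  (doubledWeilRep L e' dV hdV hdV0 (tensorFrame L dW eW dV') (tensorFrame_real L dW hdW eW dV' hdV')
                    (tensorFrame_ne_zero L dW eW dV' hdW0 hdV'0) χb hχbu hχbs) Φ) s₁ h₁) s h) →
      ∀ {n'' : ℕ} (e₁ : Fin (n + n) × Fin 1 ≃ Fin n''),
      ∃ (a' : (↥(maximalRealSubfield L))ˣ) (κ : ℂ) (_hκ : κ ≠ 0) (Φ' : piSchwartzBruhat (↥(maximalRealSubfield L)) (Fin n''))
        (hρ : HasThetaMajorants fun
          (p : ↥(UnitaryGroup.adelic (↥(maximalRealSubfield L)) L (IsCMField.complexConj L) (n + n) (Matrix.diagonal (dD L e dV hdV dW hdW))) ×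
            ↥(UnitaryGroup.adelic (↥(maximalRealSubfield L)) L (IsCMField.complexConj L) 1 (JW (↥(maximalRealSubfield L)) L a')))
          (Ψ : piSchwartzBruhat (↥(maximalRealSubfield L)) (Fin n'')) =>
            pairRep (↥(maximalRealSubfield L)) L (IsCMField.complexConj L) (n + n) 1 e₁ (Matrix.diagonal (dD L e dV hdV dW hdW)) (JW (↥(maximalRealSubfield L)) L a')
              (chiSplittingLine L e₁ (dD L e dV hdV dW hdW) (dD_conj L e dV hdV dW hdW) (dD_ne_zero L e dV hdV dW hdW hdV0 hdW0)
                (toHeckeCharacter L lam⁻¹) (isUnitary_toHeckeCharacter L lam⁻¹)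
                ((isOscillatorChar_toHeckeCharacter_iff lam⁻¹).mpr (K2LiuConjugateSymplecticInv.IsConjugateSymplectic.inv hlam)) (TW (↥(maximalRealSubfield L)) a')
                (isUnit_det_TW (↥(maximalRealSubfield L)) a') (JW (↥(maximalRealSubfield L)) L a') (JW_eq (↥(maximalRealSubfield L)) L a'))
              p Ψ)
        (μW : @Measure (↥(UnitaryGroup.adelic (↥(maximalRealSubfield L)) L (IsCMField.complexConj L) 1 (JW (↥(maximalRealSubfield L)) L a')) ⧸
          (UnitaryGroup.toAdelic (↥(maximalRealSubfield L)) L (IsCMField.complexConj L) 1 (JW (↥(maximalRealSubfield L)) L a')).range) (borel _))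
        (fw : C(↥(UnitaryGroup.adelic (↥(maximalRealSubfield L)) L (IsCMField.complexConj L) 1 (JW (↥(maximalRealSubfield L)) L a')) ⧸
          (UnitaryGroup.toAdelic (↥(maximalRealSubfield L)) L (IsCMField.complexConj L) 1 (JW (↥(maximalRealSubfield L)) L a')).range, ℂ)),
        @IsFiniteMeasure _ (borel _) μW ∧
        @SMulInvariantMeasure
          ↥(UnitaryGroup.adelic (↥(maximalRealSubfield L)) L (IsCMField.complexConj L) 1 (JW (↥(maximalRealSubfield L)) L a'))
          (↥(UnitaryGroup.adelic (↥(maximalRealSubfield L)) L (IsCMField.complexConj L) 1 (JW (↥(maximalRealSubfield L)) L a')) ⧸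
            (UnitaryGroup.toAdelic (↥(maximalRealSubfield L)) L (IsCMField.complexConj L) 1 (JW (↥(maximalRealSubfield L)) L a')).range)
          _ (borel _) μW ∧
        ∀ h : HA L e dV hdV dW hdW,
          Tendsto (fun s : ℂ => (s - 1 / 2) * (Eg s h / ∏ p ∈ Pg, (s - p))) (𝓝[≠] (1 / 2))
            (𝓝 (κ * @doubledLineThetaLift L _ _ _ 2 1 n e dV hdV dW hdW n'' e₁ hdV0 hdW0 lam⁻¹ (K2LiuConjugateSymplecticInv.IsConjugateSymplectic.inv hlam) a' hρ
              (borel _) μW Φ' fw h)) := by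
  refine firstTermIdentityOnGenerators_of_rigidityInputs h41 ?_
  -- ‹FACE-I› from FACE-T and the theta-side witness of record
  intro L _ _ _ n e dV hdV hdV0 dW hdW hdW0 lam hlam hwt M' n' eW e' dV' hdV' hdV'0 χb hχbu hχbs α hα hαrat hχD 𝒦 h𝒦 n'' e₁
  obtain ⟨a', hline⟩ := hT L e dV hdV hdV0 dW hdW hdW0 lam hlam hwt eW e' dV' hdV' hdV'0 χb hχbu hχbs α hα hαrat hχD 𝒦 h𝒦 e₁
  -- ★ p858449: Weil majorants, Haar on `[U(⟨a′⟩)]` (finite, invariant, open-pos), a character weight and `Φ′₀` with `B(Φ′₀)(1) ≠ 0` (★ U4b, seven majorants discharged)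
  obtain ⟨hρ, μW, χ, fw, Φ₀, hfin, hinv, hpos, hrat, hχc, hmk, heig, hB⟩ :=
    exists_lineThetaSide_witness L e dV hdV hdV0 dW hdW hdW0 lam⁻¹ (K2LiuConjugateSymplecticInv.IsConjugateSymplectic.inv hlam) a' e₁
  refine ⟨a', hρ, μW, fw, hfin, hinv, ?_⟩
  intro V hVfd harch T₁ hTa hTb hTc hTγ hTg
  obtain ⟨𝓣, T₂, hT₂B, hsurj, P, hP₁, hP₂, coeff, R, S, lam₀, c₁, c₂, hdet, hT₁', hT₂', h2₁, h2₂, hfin', h₁, h₂⟩ :=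
    hline hρ μW χ fw hfin hinv hpos hrat hχc hmk heig V hVfd harch T₁ hTa hTb hTc hTγ hTg
  refine ⟨𝓣, T₂, hT₂B, P, hP₁, hP₂, coeff, R, S, lam₀, c₁, c₂, hdet, hT₁', hT₂', h2₁, h2₂, hfin', h₁, h₂, ?_⟩
  -- `hne` BY NAME: a vanishing reference coefficient would kill `T₂` (★ U2 comparison at `c₀ = 0` + `hdet`), but `T₂ x₀ = B(Φ′₀) ≠ 0`
  obtain ⟨x₀, hx₀⟩ := hsurj Φ₀
  intro h0
  have hall := rankOneCoefficientComparison
    (D := ↥(Submodule.span ℂ {x : piSchwartzBruhat (Fp L) (Fin (n' + n')) |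
      ∃ a ∈ V, ∃ f : FinSB (Fp L) (Fin (n' + n')), x = piSchwartzBruhatEquiv (Fp L) (Fin (n' + n')) (a ⊗ₜ[ℂ] f)}))
    (M := HA L e dV hdV dW hdW → ℂ) L
    (fun β => coeff β ∘ₗ LinearMap.codRestrict P T₂ hP₂) (fun β => coeff β ∘ₗ LinearMap.codRestrict P T₂ hP₂) a' R S hT₂' hT₂' h2₂ h2₂
    (fun b u hu hne => hfin' b u hu (Or.inr (hne.elim id id))) (c₀ := 0) (by rw [zero_smul]; exact h0)
  have hzero : LinearMap.codRestrict P T₂ hP₂ x₀ = 0 := hdet _ fun β hβh hβ0 => by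
    have hx := LinearMap.congr_fun (hall β hβh hβ0) x₀
    simpa only [zero_smul, LinearMap.zero_apply, LinearMap.coe_comp, Function.comp_apply] using hx
  have hval : T₂ x₀ = 0 := by
    have hv := congrArg Subtype.val hzero
    simpa only [LinearMap.codRestrict_apply, ZeroMemClass.coe_zero] using hv
  apply hB
  rw [← hx₀, ← hT₂B x₀ 1, hval, Pi.zero_apply]

end Summit.HodgeConjecture.HodgeConjecture.Cruxes.HLiu418.K2LiuFirstTermIdentityAssemblyTheta

end
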